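/-
HONEST FRAMING (page 1): per-curve certified theorems and census instruments; no claim on BSD in
rank ≥ 2.

# Rank-2 observatory, rank-3 arm — `E[p]` at Mazur's twelve primes DECIDED, part II of III: the
# extended Frobenius sieve and chunks `01 … 13` (KCI row 59)

Zero-kit, zero-data sequel of `…Rank3ReduciblePairs` (row 58: the listed reducible pairs `redTwoB`,
`redThreeB`, `redFive`, lookups `redTwoAt` / `redThreeAt` / `isRed`, the root checks and their
soundness).  Here:
* §1 THE EXTENDED SIEVE: witness primes `ℓ ∈ {3, 5, …, 79}` (the 21 odd primes `≤ 79`), NO cut-off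
  for `p = 2` (row 56 stopped driving `p = 2` at `ℓ = 13` and all primes at `ℓ = 31`), started on
  Mazur's twelve primes MINUS the row's listed pairs (`pending0 i`); a step at a good `ℓ` drops every
  pending `p ≠ ℓ` with `X² − a_ℓ X + ℓ` rootless mod `p` (`norootB`, row 56), `a_ℓ = apInt r ℓ`
  (row 56's kernel evaluator, PROVED equal to `frobeniusTrace`).  The sieve invariant and
  `hasIrreducibleModPGaloisRep_of_not_mem_uncertified2`: a prime that left the pending list is
  certified — `E_r[p]` IRREDUCIBLE, hypothesis-free (Mazur's Frobenius criterion, PROVED in the tree).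
* §2 THE ROW PREDICATE `rowDecidedB r i`: the sieve empties AND the listed root checks of row 58
  pass; `decidedGo` folds it along a chunk with a running row index; `decidedGo_getElem?`,
  `decidedGo_append` (for the assembly in part III) and `of_rowDecidedB` (the row reading: irreducible
  at every Mazur prime off the listed pairs, reducible on the listed pairs at `2` and `3`).
* §3 CHUNKS `01 … 13` (rows `0 … 4575`): `decidedGo rank3RowsNN (352·(NN−1)) = true`, one kernel pass
  each (`decide +kernel`).  Part III proves chunks `14 … 27` and assembles the table theorem.
By itself this part decides rows `0 … 4575` only through `of_rowDecidedB` applied to a chunk theorem;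
nothing is claimed about any other prime, any `L`-value, Selmer group or BSD.
References: B. Mazur, *Rational isogenies of prime degree*, Invent. Math. 44 (1978), §6, Thm 1;
J. H. Silverman, *The Arithmetic of Elliptic Curves*, GTM 106 (2009), III.2.3, Ex. 3.7, V.2, VII.5.1;
J. E. Cremona, *Algorithms for Modular Elliptic Curves* (1997), §3.8 and Tables; J.-P. Serre,
*Propriétés galoisiennes des points d'ordre fini des courbes elliptiques*, Invent. Math. 15 (1972),
§5.4–5.5.
-/
import Summits.BirchSwinnertonDyer.BirchSwinnertonDyer.Theorems.Rank2ObservatoryRank3ReduciblePairs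
import HarnessLib

set_option linter.dupNamespace false
set_option autoImplicit false

open Literature Literature.NumberTheory.EllipticCurves WeierstrassCurve Polynomial

namespace Summit.BirchSwinnertonDyer.BirchSwinnertonDyer.Rank2Observatory

/-! ## §1 The extended sieve (witnesses `3 … 79`, no `p = 2` cut-off, listed pairs removed) -/
/-- the 21 odd witness primes `≤ 79`. [folklore] -/
def witnessPrimes2 : List ℕ :=
  [3, 5, 7, 11, 13, 17, 19, 23, 29, 31, 37, 41, 43, 47, 53, 59, 61, 67, 71, 73, 79]
/-- every extended witness is an odd prime. [folklore] -/
theorem witnessPrimes2_prime : ∀ ℓ ∈ witnessPrimes2, ℓ.Prime ∧ ℓ ≠ 2 := by decide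
/-- the Mazur primes to certify at row index `i`. [folklore] -/
def pending0 (i : ℕ) : List ℕ := mazurList.filter fun p => !(isRed i p)

/-- one extended sieve step at the witness prime `ℓ` (runs iff something is pending and `ℓ ∤ Δ`).
[folklore] -/
def Rank3Row.sieveStep2 (r : Rank3Row) (pending : List ℕ) (ℓ : ℕ) : List ℕ :=
  if pending.isEmpty || r.delta % (ℓ : ℤ) == 0 then pending
  else
    let a := r.apInt ℓ
    pending.filter fun p => !(ℓ != p && norootB a ℓ p)
/-- the pending primes of row `r` (index `i`) left after the extended sieve. [folklore] -/
def Rank3Row.uncertified2 (r : Rank3Row) (i : ℕ) : List ℕ :=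
  witnessPrimes2.foldl r.sieveStep2 (pending0 i)

/-- Invariant of the extended sieve: a prime that was pending and is absent from the output was
dropped at a good witness prime `ℓ ≠ p` where `norootB (a_ℓ) ℓ p` holds. [folklore] -/
theorem Rank3Row.exists_witness_of_not_mem_foldl2 (r : Rank3Row) (p : ℕ) :
    ∀ (L pending : List ℕ), p ∈ pending → p ∉ L.foldl r.sieveStep2 pending →
      ∃ ℓ ∈ L, ℓ ≠ p ∧ ¬ ((ℓ : ℤ) ∣ r.delta) ∧ norootB (r.apInt ℓ) ℓ p = true := by
  intro L
  induction L with
  | nil => intro pending hp hn; exact absurd hp hn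
  | cons ℓ L ih =>
    intro pending hp hn
    rw [List.foldl_cons] at hn
    by_cases hstep : p ∈ r.sieveStep2 pending ℓ
    · obtain ⟨ℓ', hℓ', h⟩ := ih _ hstep hn
      exact ⟨ℓ', List.mem_cons_of_mem _ hℓ', h⟩
    · refine ⟨ℓ, List.mem_cons_self, ?_⟩
      unfold Rank3Row.sieveStep2 at hstep
      split_ifs at hstep with hc
      · exact absurd hp hstep
      · rw [List.mem_filter, not_and, Bool.not_eq_true', Bool.not_eq_false, Bool.and_eq_true,
          bne_iff_ne] at hstep
        obtain ⟨hne, hnr⟩ := hstep hp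
        refine ⟨hne, ?_, hnr⟩
        rw [Int.dvd_iff_emod_eq_zero]
        intro h0; exact hc (by simp [h0])

/-- **A prime certified by the extended sieve is irreducible** — hypothesis-free (row 56's
`apInt = frobeniusTrace` and Mazur's Frobenius criterion). [cite: Mazur1978, §6] -/
theorem Rank3Row.hasIrreducibleModPGaloisRep_of_not_mem_uncertified2 {r : Rank3Row}
    (hr : r ∈ rank3Table) (i p : ℕ) [Fact p.Prime] (hp : p ∈ pending0 i)
    (hn : p ∉ r.uncertified2 i) : r.curve.HasIrreducibleModPGaloisRep p := by
  haveI := isElliptic_of_mem hr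
  haveI := Rank3Row.isGloballyMinimal_of_mem hr
  obtain ⟨ℓ, hℓ, hℓp, hgood, hnr⟩ :=
    r.exists_witness_of_not_mem_foldl2 p witnessPrimes2 (pending0 i) hp hn
  haveI : Fact ℓ.Prime := ⟨(witnessPrimes2_prime ℓ hℓ).1⟩
  refine hasIrreducibleModPGaloisRep_of_frobeniusTrace_noroot r.curve p ℓ hℓp
    (Rank3Row.hasGoodReductionAtPrime_of_not_dvd hr ℓ hgood) ?_
  rw [Rank3Row.frobeniusTrace_eq_apInt hr ℓ (witnessPrimes2_prime ℓ hℓ).2 hgood]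
  exact noroot_of_norootB _ ℓ p hnr

/-! ## §2 The row predicate and its fold along a chunk -/
/-- row `r` at index `i` is DECIDED: nothing pending, and its listed root checks pass. [folklore] -/
def Rank3Row.rowDecidedB (r : Rank3Row) (i : ℕ) : Bool :=
  (r.uncertified2 i).isEmpty && r.redChecksB i
/-- `rowDecidedB` along a chunk whose first row has index `i`. [folklore] -/
def decidedGo : List Rank3Row → ℕ → Bool
  | [], _ => true
  | r :: rs, i => r.rowDecidedB i && decidedGo rs (i + 1)

/-- `decidedGo` decides every row of the chunk at its index. [folklore] -/
theorem decidedGo_getElem? : ∀ (rows : List Rank3Row) (i j : ℕ) (r : Rank3Row),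
    decidedGo rows i = true → rows[j]? = some r → r.rowDecidedB (i + j) = true := by
  intro rows
  induction rows with
  | nil => intro i j r _ h; simp at h
  | cons r₀ rs ih =>
    intro i j r hgo h
    simp only [decidedGo, Bool.and_eq_true] at hgo
    cases j with
    | zero =>
      simp only [List.getElem?_cons_zero, Option.some.injEq] at h
      subst h; simpa using hgo.1
    | succ j =>
      simp only [List.getElem?_cons_succ] at h
      have := ih (i + 1) j r hgo.2 h
      rwa [show i + 1 + j = i + (j + 1) by ring] at this

/-- `decidedGo` splits along an append. [folklore] -/
theorem decidedGo_append : ∀ (l₁ l₂ : List Rank3Row) (i : ℕ),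
    decidedGo (l₁ ++ l₂) i = (decidedGo l₁ i && decidedGo l₂ (i + l₁.length)) := by
  intro l₁
  induction l₁ with
  | nil => intro l₂ i; simp [decidedGo]
  | cons r rs ih =>
    intro l₂ i
    simp only [List.cons_append, decidedGo, ih, List.length_cons, Bool.and_assoc]
    congr 2
    rw [show i + 1 + rs.length = i + (rs.length + 1) by ring]

/-- **A decided row**: every Mazur prime off the row's listed pairs is certified IRREDUCIBLE; a
listed pair at `2` or `3` is certified REDUCIBLE — hypothesis-free. [cite: Mazur1978, §6] -/
theorem Rank3Row.of_rowDecidedB {r : Rank3Row} (hr : r ∈ rank3Table) {i : ℕ}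
    (h : r.rowDecidedB i = true) :
    (∀ p ∈ mazurPrimes, isRed i p = false → ∀ [Fact p.Prime], r.curve.HasIrreducibleModPGaloisRep p)
    ∧ (∀ X, redTwoAt i = some X → ¬ r.curve.HasIrreducibleModPGaloisRep 2)
    ∧ (∀ X, redThreeAt i = some X → ¬ r.curve.HasIrreducibleModPGaloisRep 3) := by
  simp only [Rank3Row.rowDecidedB, Bool.and_eq_true, List.isEmpty_iff] at h
  obtain ⟨hnil, hred⟩ := h
  refine ⟨fun p hp hred _ => ?_, Rank3Row.of_redChecksB hr hred⟩
  refine Rank3Row.hasIrreducibleModPGaloisRep_of_not_mem_uncertified2 hr i p ?_ (by simp [hnil])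
  rw [← mazurList_toFinset, List.mem_toFinset] at hp
  simp [pending0, hp, hred]

/-! ## §3 Chunks `01 … 13` (rows `0 … 4575`; one kernel pass per chunk) -/
section decidedI
set_option maxHeartbeats 2000000
/-- chunk `01` (row indices `0 … 351`): all decided. [folklore] -/ theorem decided01 : decidedGo rank3Rows01 0 = true := by decide +kernel
/-- chunk `02` (row indices `352 … 703`): all decided. [folklore] -/ theorem decided02 : decidedGo rank3Rows02 352 = true := by decide +kernel
/-- chunk `03` (row indices `704 … 1055`): all decided. [folklore] -/ theorem decided03 : decidedGo rank3Rows03 704 = true := by decide +kernel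
/-- chunk `04` (row indices `1056 … 1407`): all decided. [folklore] -/ theorem decided04 : decidedGo rank3Rows04 1056 = true := by decide +kernel
/-- chunk `05` (row indices `1408 … 1759`): all decided. [folklore] -/ theorem decided05 : decidedGo rank3Rows05 1408 = true := by decide +kernel
/-- chunk `06` (row indices `1760 … 2111`): all decided. [folklore] -/ theorem decided06 : decidedGo rank3Rows06 1760 = true := by decide +kernel
/-- chunk `07` (row indices `2112 … 2463`): all decided. [folklore] -/ theorem decided07 : decidedGo rank3Rows07 2112 = true := by decide +kernel
/-- chunk `08` (row indices `2464 … 2815`): all decided. [folklore] -/ theorem decided08 : decidedGo rank3Rows08 2464 = true := by decide +kernel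
/-- chunk `09` (row indices `2816 … 3167`): all decided. [folklore] -/ theorem decided09 : decidedGo rank3Rows09 2816 = true := by decide +kernel
/-- chunk `10` (row indices `3168 … 3519`): all decided. [folklore] -/ theorem decided10 : decidedGo rank3Rows10 3168 = true := by decide +kernel
/-- chunk `11` (row indices `3520 … 3871`): all decided. [folklore] -/ theorem decided11 : decidedGo rank3Rows11 3520 = true := by decide +kernel
/-- chunk `12` (row indices `3872 … 4223`): all decided. [folklore] -/ theorem decided12 : decidedGo rank3Rows12 3872 = true := by decide +kernel
/-- chunk `13` (row indices `4224 … 4575`): all decided. [folklore] -/ theorem decided13 : decidedGo rank3Rows13 4224 = true := by decide +kernel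
end decidedI

end Summit.BirchSwinnertonDyer.BirchSwinnertonDyer.Rank2Observatory
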